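import Literature.Computability.Cryptography.DihedralHSPSampleComplexity
import Mathlib.Analysis.SpecialFunctions.Pow.Real
import HarnessLib

/-!
# Kuperberg's 2005 dihedral sieve: survival of the stage lists (Theorem 3.1)

G. Kuperberg, *A subexponential-time quantum algorithm for the dihedral hidden subgroup
problem*, SIAM J. Comput. 35 (2005) 170–188, arXiv:quant-ph/0302112, §3 (Algorithm 1) and
§3.1, Theorem 3.1 with its proof [cite: Kuperberg2005, §3.1 Thm 3.1].

## The printed argument

Algorithm 1 (hidden reflection in `D_N`, `N = 2ⁿ`, `m = ⌈√(n-1)⌉`) keeps lists `L₀, …, L_m` of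
qubits `|ψ_k⟩ ∝ |0⟩ + exp(2πi k s/N)|1⟩` with known labels `k`; a label in `L_j` has at least
`m j` trailing zeroes.  Stage `j` divides `L_j` into pairs whose labels share `m` further low
bits and extracts `|ψ_{k ± ℓ}⟩` from each pair, the sign being an unbiased coin
("The extraction makes an unbiased random choice between `k + ℓ` and `k - ℓ`", §3; the Born
masses `1/2, 1/2` of this parity measurement are `Collimation.bornMass_pair`,
`Collimation.state_pair_unequal` of `CollimationSieve.lean`); `L_{j+1}` keeps the differences.
The proof of Theorem 3.1 (p. 6 of the arXiv version) is a statement about LIST SIZES only: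

* a maximal set `P_j` of disjoint pairs with `m` matching low bits has
  `|P_j| ≥ (|L_j| - 2^m)/2` "because there are at most `2^m` unmatched" labels
  (`pairs_lower_bound` below; trivially `|P_j| ≤ |L_j|/2`, `pairs_upper_bound`);
* "`|L_{j+1}|` can be understood as the sum of `N = |P_j|` independent, unbiased Bernoulli
  random variables", and `P[B_N ≤ (1-b)N/2] ≤ e^{-N b²/2}` (Chernoff) — `coin_lower_tail`;
* with `b = 2^{j - 4m/3}` every stage keeps its list above `C · 2^{3m-2j}` except with
  probability `e^{-2^{m/3-1}}`, for constants `3 = C₀ ≤ C_k < 9`; hence, starting from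
  `|L₀| = Θ(8^m)`, `P[|L_j| ≥ C 2^{3m-2j} ∀ j] ≥ (1 - e^{-2^{m/3-1}})^m → 1` — `kuperberg2005_thm31`.

## The model (exactly the one the printed proof uses)

Only list sizes are tracked.  From a list of size `s` at stage `j`, ANY number `p` of disjoint
pairs with `(s - 2^m)/2 ≤ p ≤ s/2` may be formed (`admissiblePairs`; the true number depends on
the random labels, so we take the WORST case, an infimum, at every stage); the `p` extractions
are independent fair coins `ω : Fin p → Bool` (uniform law, weight `(1/2)^p`), and the next list
has size `survivors ω = #{i | ω i}`.  `survive M F i j s` is the resulting worst-case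
probability that, from size `s` at stage `j` with `i` stages to go, every later list `L_{j'}`
(`j < j' ≤ j + i`) has size at least `F j'` (backward value recursion of this finite-horizon
chain, `survive_succ`).  Nothing about quantum states, oracles or running time is modelled: the
file certifies the `O(8^{√n})` list-size bookkeeping of [Kuperberg2005, Thm 3.1], beside
`CollimationSieve.lean` (the 2013 collimation sieve) and `DihedralHSPSampleComplexity.lean`
(Ettinger–Høyer sample complexity); it does not discharge the circuit-level fact
`DCP.kuperberg_dihedralCosetSieve`.

## Constants, and a reading note

We run the printed recursion FORWARD: `A₀ = 9`, `A_{j+1} = (1 - b_j)(A_j - (2^m+1)/R_j)` with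
`R_j = 8^m/4^j = 2^{3m-2j}` and `b_j = 2^j/(2^m·2^{m/3}) = 2^{j-4m/3}` (`bCoef`), and show
`3 ≤ A_j ≤ 9` for all `j ≤ m`, `m ≥ 1` (`three_le_A`; only `2^{m/3} ≥ 2 - 2^{1-m}` is used).
The invariant `|L_j| ≥ A_j R_j` then propagates with failure `≤ e^{-2^{m/3-1}}` per stage
(`kuperberg_stage`: `|P_j| b_j² ≥ 2^{m/3}` and `(1-b_j)|P_j|/2 ≥ A_{j+1}R_{j+1}`), which gives
the printed statement with the printed floor constant `C₀ = 3`, the printed initial size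
`< 9 · 8^m`, the printed `b_j` and the printed per-stage and total probabilities.  The printed
proof writes the invariant once as `|L_j| ≥ C_{m-j} 2^{3m-2j}` and once with `C_j`, and sets
`|L₀| = C₀ 2^{3m}` where `lim C_k < 9` is what is used; the forward form above is the consistent
reading (the `+1` in `2^m + 1` absorbs the integer part in `(s - 2^m)/2`).

## Main statements

* `pairs_lower_bound`, `pairs_upper_bound` : `Σ_c ⌊n_c/2⌋` pairs, `(s - M)/2 ≤ · ≤ s/2`.
* `coin_lower_tail` : `P[#heads ≤ (1-b)p/2] ≤ exp(-p b²/2)` for `p` fair coins.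
* `le_survive_of_invariant` : generic product bound `survive ≥ (1-ε)^i` from a one-stage bound.
* `three_le_A`, `A_le_nine` : the constants.
* `kuperberg_stage` : one stage of [Kuperberg2005, Thm 3.1].
* `kuperberg2005_thm31` : `(1 - exp(-2^{m/3-1}))^m ≤ survive (2^m) (3·8^m/4^j) m 0 s₀` for
  `s₀ ≥ 9·8^m`, `m ≥ 1`.
-/

namespace Literature.Computability.Cryptography.KuperbergSieve

open Finset Real
open Literature.Computability.Cryptography.DihedralHSP (hoeffding_weighted_pi_Icc)

noncomputable section

/-! ### Pairing counts -/

/-- With `n c` labels in low-bit class `c` (`M` classes), a maximal family of disjoint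
same-class pairs has `Σ_c ⌊n_c/2⌋` members, hence at least `(s - M)/2` of the `s = Σ_c n_c`
labels are paired up: "there are at most `2^m` unmatched" [cite: Kuperberg2005, §3.1 proof of Thm 3.1]. -/
theorem pairs_lower_bound {M : ℕ} (n : Fin M → ℕ) :
    ((∑ c, n c) - M) / 2 ≤ ∑ c, n c / 2 := by
  have h : ∑ c, n c ≤ 2 * ∑ c, n c / 2 + M := by
    calc ∑ c, n c ≤ ∑ c : Fin M, (2 * (n c / 2) + 1) := sum_le_sum fun c _ => by omega
      _ = 2 * ∑ c, n c / 2 + M := by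
        rw [sum_add_distrib, ← mul_sum, sum_const, card_univ, Fintype.card_fin, smul_eq_mul,
          mul_one]
  omega

/-- Disjoint pairs inside the classes use each label at most once: at most `s/2` pairs.
[cite: Kuperberg2005, §3.1 proof of Thm 3.1] -/
theorem pairs_upper_bound {M : ℕ} (n : Fin M → ℕ) :
    ∑ c, n c / 2 ≤ (∑ c, n c) / 2 := by
  have h : 2 * ∑ c, n c / 2 ≤ ∑ c, n c := by
    rw [mul_sum]
    exact sum_le_sum fun c _ => Nat.mul_div_le (n c) 2
  omega

/-- The admissible numbers of pairs formed from a list of size `s` with `M = 2^m` low-bit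
classes: every `p` with `(s - M)/2 ≤ p ≤ s/2` (`pairs_lower_bound`, `pairs_upper_bound`).
[cite: Kuperberg2005, §3.1 proof of Thm 3.1] -/
def admissiblePairs (M s : ℕ) : Finset ℕ := Icc ((s - M) / 2) (s / 2)

/-- There is always an admissible number of pairs (`(s - M)/2 ≤ s/2`). [cite: Kuperberg2005, §3.1 proof of Thm 3.1] -/
theorem admissiblePairs_nonempty (M s : ℕ) : (admissiblePairs M s).Nonempty :=
  nonempty_Icc.2 (Nat.div_le_div_right (Nat.sub_le s M))

/-- Membership in `admissiblePairs`: `(s - M)/2 ≤ p ≤ s/2`. [cite: Kuperberg2005, §3.1 proof of Thm 3.1] -/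
theorem mem_admissiblePairs {M s p : ℕ} :
    p ∈ admissiblePairs M s ↔ (s - M) / 2 ≤ p ∧ p ≤ s / 2 := mem_Icc

/-! ### One stage: fair coins -/

/-- The number of extractions (out of `p`) that returned the difference label `k - ℓ`, i.e. the
size of the next list, as a function of the `p` fair coins. [cite: Kuperberg2005, §3 Algorithm 1 step 2] -/
def survivors {p : ℕ} (ω : Fin p → Bool) : ℕ := (univ.filter fun i => ω i = true).card

/-- The next list is at most as long as the number of pairs. [cite: Kuperberg2005, §3.1 proof of Thm 3.1] -/
theorem survivors_le {p : ℕ} (ω : Fin p → Bool) : survivors ω ≤ p := by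
  unfold survivors
  exact (card_filter_le _ _).trans (by rw [card_univ, Fintype.card_fin])

/-- The value of one stage with `p` pairs against a continuation `V` on the size of the next
list: `E[V(#survivors)]` under `p` independent fair coins (weight `(1/2)^p` each).
[cite: Kuperberg2005, §3.1 proof of Thm 3.1 ("sum of N independent, unbiased Bernoulli random variables")] -/
def stageValue (p : ℕ) (V : ℕ → ℝ) : ℝ :=
  ∑ ω : Fin p → Bool, (1 / 2 : ℝ) ^ p * V (survivors ω)

/-- The fair-coin weights sum to one (helper). [folklore] -/
private theorem sum_coinWeight (p : ℕ) : ∑ _ω : Fin p → Bool, (1 / 2 : ℝ) ^ p = 1 := by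
  rw [sum_const, card_univ, Fintype.card_fun, Fintype.card_bool, Fintype.card_fin, nsmul_eq_mul,
    Nat.cast_pow, Nat.cast_ofNat, ← mul_pow]
  norm_num

/-- The stage value is monotone in the continuation (on the reachable sizes `t ≤ p`). [cite: Kuperberg2005, §3.1 proof of Thm 3.1] -/
theorem stageValue_mono {p : ℕ} {V W : ℕ → ℝ} (h : ∀ t, t ≤ p → V t ≤ W t) :
    stageValue p V ≤ stageValue p W :=
  sum_le_sum fun ω _ => mul_le_mul_of_nonneg_left (h _ (survivors_le ω)) (by positivity)

/-- The stage value of a nonnegative continuation is nonnegative. [cite: Kuperberg2005, §3.1 proof of Thm 3.1] -/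
theorem stageValue_nonneg {p : ℕ} {V : ℕ → ℝ} (h : ∀ t, 0 ≤ V t) : 0 ≤ stageValue p V :=
  sum_nonneg fun ω _ => mul_nonneg (by positivity) (h _)

/-- The stage value is linear in the continuation. [cite: Kuperberg2005, §3.1 proof of Thm 3.1] -/
theorem stageValue_const_mul (p : ℕ) (a : ℝ) (V : ℕ → ℝ) :
    stageValue p (fun t => a * V t) = a * stageValue p V := by
  unfold stageValue
  rw [mul_sum]
  exact sum_congr rfl fun ω _ => by ring

/-- The fair-coin law has total mass one. [cite: Kuperberg2005, §3.1 proof of Thm 3.1] -/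
theorem stageValue_one (p : ℕ) : stageValue p (fun _ => 1) = 1 := by
  unfold stageValue
  simp_rw [mul_one]
  exact sum_coinWeight p

/-- The probability of an event of the survivor count is one minus that of its complement
(helper). [folklore] -/
private theorem stageValue_indicator_compl (p : ℕ) (E : ℕ → Prop) [DecidablePred E] :
    stageValue p (fun t => if E t then 1 else 0) =
      1 - stageValue p (fun t => if E t then 0 else 1) := by
  rw [eq_sub_iff_add_eq]
  unfold stageValue
  rw [← sum_add_distrib]
  refine Eq.trans (sum_congr rfl fun ω _ => ?_) (sum_coinWeight p)
  dsimp only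
  split_ifs <;> ring

/-- Chernoff/Hoeffding lower tail for `p ≥ 1` fair coins: the probability of at most
`(1-b)p/2` heads is at most `exp(-p b²/2)` — the inequality
`P[B_N ≤ (1-b)N/2] ≤ e^{-N b²/2}` of the printed proof, obtained from the range-form Hoeffding
inequality `DihedralHSP.hoeffding_weighted_pi_Icc` with the centred variables
`1/2 - [ωᵢ] ∈ [-1/2, 1/2]`. [cite: Kuperberg2005, §3.1 proof of Thm 3.1] -/
theorem coin_lower_tail {p : ℕ} (hp : 0 < p) {b : ℝ} (hb : 0 ≤ b) :
    stageValue p (fun t => if (t : ℝ) ≤ (1 - b) * p / 2 then 1 else 0) ≤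
      Real.exp (-(p * b ^ 2 / 2)) := by
  classical
  -- centred coin variables
  set f : Fin p → Bool → ℝ := fun _ x => if x = true then -(1 / 2) else 1 / 2 with hf
  set w : Fin p → Bool → ℝ := fun _ _ => 1 / 2 with hw
  have hw0 : ∀ i x, 0 ≤ w i x := fun _ _ => by simp [hw]
  have hw1 : ∀ i, ∑ x, w i x = 1 := fun _ => by simp [hw]
  have hfI : ∀ i x, f i x ∈ Set.Icc (-(1 / 2) : ℝ) (1 / 2) := fun _ x => by
    cases x <;> simp [hf]
  have hf0 : ∀ i, ∑ x, w i x * f i x = 0 := fun _ => by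
    simp [hw, hf]
  have hS : (0 : ℝ) < ∑ _i : Fin p, ((1 / 2 : ℝ) - -(1 / 2)) ^ 2 := by
    rw [sum_const, card_univ, Fintype.card_fin, nsmul_eq_mul]
    have : (0 : ℝ) < p := by exact_mod_cast hp
    positivity
  have hsumsq : ∑ _i : Fin p, ((1 / 2 : ℝ) - -(1 / 2)) ^ 2 = (p : ℝ) := by
    rw [sum_const, card_univ, Fintype.card_fin, nsmul_eq_mul]; norm_num
  have ht : (0 : ℝ) ≤ b * p / 2 := by positivity
  have H := hoeffding_weighted_pi_Icc w f (fun _ => -(1 / 2)) (fun _ => 1 / 2) hw0 hw1 hfI hf0 ht hS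
  rw [hsumsq] at H
  -- the sum of the centred variables is `p/2 - survivors`
  have hsumf : ∀ ω : Fin p → Bool, ∑ i, f i (ω i) = p / 2 - (survivors ω : ℝ) := by
    intro ω
    have h1 : ∀ i, f i (ω i) = 1 / 2 - (if ω i = true then 1 else 0) := fun i => by
      simp only [hf]; split_ifs <;> norm_num
    simp_rw [h1, sum_sub_distrib, sum_const, card_univ, Fintype.card_fin, nsmul_eq_mul]
    simp only [survivors]
    rw [natCast_card_filter]
    ring
  -- the product weight is `(1/2)^p`
  have hprodw : ∀ ω : Fin p → Bool, ∏ i, w i (ω i) = (1 / 2 : ℝ) ^ p := fun ω => by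
    simp only [hw, prod_const, card_univ, Fintype.card_fin]
  -- compare the two events
  have hle : stageValue p (fun t => if (t : ℝ) ≤ (1 - b) * p / 2 then 1 else 0) ≤
      ∑ y ∈ univ.filter (fun y : Fin p → Bool => b * p / 2 ≤ ∑ i, f i (y i)), ∏ i, w i (y i) := by
    unfold stageValue
    simp_rw [mul_ite, mul_one, mul_zero]
    rw [← sum_filter]
    simp_rw [hprodw]
    refine sum_le_sum_of_subset_of_nonneg ?_ fun y _ _ => by positivity
    intro ω hω
    rw [mem_filter] at hω ⊢
    refine ⟨mem_univ _, ?_⟩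
    rw [hsumf]
    linarith [hω.2]
  have hp' : (p : ℝ) ≠ 0 := Nat.cast_ne_zero.2 hp.ne'
  refine hle.trans (H.trans_eq ?_)
  congr 1
  field_simp

/-! ### The survival recursion -/

/-- `survive M F i j s`: the worst case, over all admissible numbers of pairs at every stage,
of the probability that starting at stage `j` from a list of size `s`, with `i` stages to go,
every later list meets its floor, `F j' ≤ |L_{j'}|` for `j < j' ≤ j + i` (finite-horizon value
recursion of the list-size chain: fair coins per stage, `M = 2^m` low-bit classes).
[cite: Kuperberg2005, §3.1 proof of Thm 3.1] -/
def survive (M : ℕ) (F : ℕ → ℝ) : ℕ → ℕ → ℕ → ℝ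
  | 0, _, _ => 1
  | i + 1, j, s => (admissiblePairs M s).inf' (admissiblePairs_nonempty M s) fun p =>
      stageValue p fun t => if F (j + 1) ≤ (t : ℝ) then survive M F i (j + 1) t else 0

/-- No stages to go: certain survival. [cite: Kuperberg2005, §3.1 proof of Thm 3.1] -/
@[simp] theorem survive_zero (M : ℕ) (F : ℕ → ℝ) (j s : ℕ) : survive M F 0 j s = 1 := rfl

/-- The backward recursion: worst admissible stage, then the floor test on the next list. [cite: Kuperberg2005, §3.1 proof of Thm 3.1] -/
theorem survive_succ (M : ℕ) (F : ℕ → ℝ) (i j s : ℕ) :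
    survive M F (i + 1) j s = (admissiblePairs M s).inf' (admissiblePairs_nonempty M s) fun p =>
      stageValue p fun t => if F (j + 1) ≤ (t : ℝ) then survive M F i (j + 1) t else 0 := rfl

/-- Survival probabilities are nonnegative. [cite: Kuperberg2005, §3.1 proof of Thm 3.1] -/
theorem survive_nonneg (M : ℕ) (F : ℕ → ℝ) : ∀ i j s, 0 ≤ survive M F i j s
  | 0, _, _ => by simp
  | i + 1, j, s => by
    rw [survive_succ]
    refine Finset.le_inf' _ _ fun p _ => stageValue_nonneg fun t => ?_
    split_ifs
    · exact survive_nonneg M F i (j + 1) t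
    · exact le_rfl

/-- Survival probabilities are at most one. [cite: Kuperberg2005, §3.1 proof of Thm 3.1] -/
theorem survive_le_one (M : ℕ) (F : ℕ → ℝ) : ∀ i j s, survive M F i j s ≤ 1
  | 0, _, _ => by simp
  | i + 1, j, s => by
    rw [survive_succ]
    obtain ⟨p, hp⟩ := admissiblePairs_nonempty M s
    refine (Finset.inf'_le _ hp).trans ?_
    rw [← stageValue_one p]
    refine stageValue_mono fun t _ => ?_
    split_ifs
    · exact survive_le_one M F i (j + 1) t
    · exact zero_le_one

/-- Generic survival bound.  If the floors `F` are dominated by invariant floors `G` on the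
stages `≤ m`, and from every list meeting `G j` (`j < m`) each admissible stage keeps the next
list above `G (j+1)` except with probability `ε ≤ 1`, then from stage `j` with `i` stages to go
(`j + i ≤ m`) all floors are met with probability at least `(1 - ε)^i` — the induction
"`P[… ∀ j] ≥ (1 - e^{…})^m`" of the printed proof. [cite: Kuperberg2005, §3.1 proof of Thm 3.1] -/
theorem le_survive_of_invariant {M m : ℕ} {F G : ℕ → ℝ} {ε : ℝ} (hε : ε ≤ 1)
    (hFG : ∀ j, j ≤ m → F j ≤ G j)
    (hstage : ∀ j, j < m → ∀ s : ℕ, G j ≤ s → ∀ p ∈ admissiblePairs M s,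
      1 - ε ≤ stageValue p (fun t => if G (j + 1) ≤ (t : ℝ) then 1 else 0)) :
    ∀ (i j s : ℕ), j + i ≤ m → G j ≤ (s : ℝ) → (1 - ε) ^ i ≤ survive M F i j s := by
  intro i
  induction i with
  | zero => intro j s _ _; simp
  | succ i ih =>
    intro j s hij hs
    rw [survive_succ]
    refine Finset.le_inf' _ _ fun p hp => ?_
    have h1 : 1 - ε ≤ stageValue p (fun t => if G (j + 1) ≤ (t : ℝ) then 1 else 0) :=
      hstage j (by omega) s hs p hp
    have hε0 : 0 ≤ 1 - ε := sub_nonneg.2 hε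
    calc (1 - ε) ^ (i + 1) = (1 - ε) ^ i * (1 - ε) := pow_succ _ _
      _ ≤ (1 - ε) ^ i * stageValue p (fun t => if G (j + 1) ≤ (t : ℝ) then 1 else 0) :=
          mul_le_mul_of_nonneg_left h1 (pow_nonneg hε0 i)
      _ = stageValue p (fun t => if G (j + 1) ≤ (t : ℝ) then (1 - ε) ^ i else 0) := by
          rw [← stageValue_const_mul]
          congr 1; funext t; split_ifs <;> simp
      _ ≤ stageValue p (fun t => if F (j + 1) ≤ (t : ℝ) then survive M F i (j + 1) t else 0) := by
          refine stageValue_mono fun t _ => ?_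
          by_cases hG : G (j + 1) ≤ (t : ℝ)
          · rw [if_pos hG, if_pos ((hFG (j + 1) (by omega)).trans hG)]
            exact ih (j + 1) t (by omega) hG
          · rw [if_neg hG]
            split_ifs
            · exact survive_nonneg M F i (j + 1) t
            · exact le_rfl

/-! ### Kuperberg's constants -/

/-- `θ = 2^{m/3}` (so `θ³ = 2^m`); the printed deviation parameter is `b_j = 2^{j-4m/3} =
2^j/(2^m θ)` and the printed per-stage failure probability is `e^{-2^{m/3-1}} = e^{-θ/2}`.
[cite: Kuperberg2005, §3.1 proof of Thm 3.1] -/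
def theta (m : ℕ) : ℝ := (2 : ℝ) ^ ((m : ℝ) / 3)

/-- `2^{m/3} > 0`. [cite: Kuperberg2005, §3.1 proof of Thm 3.1] -/
theorem theta_pos (m : ℕ) : 0 < theta m := Real.rpow_pos_of_pos two_pos _

/-- `(2^{m/3})³ = 2^m`. [cite: Kuperberg2005, §3.1 proof of Thm 3.1] -/
theorem theta_pow_three (m : ℕ) : theta m ^ 3 = 2 ^ m := by
  unfold theta
  rw [← Real.rpow_natCast, ← Real.rpow_mul (by norm_num : (0 : ℝ) ≤ 2)]
  rw [show (m : ℝ) / 3 * ((3 : ℕ) : ℝ) = (m : ℝ) by push_cast; ring, Real.rpow_natCast]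

/-- `1 ≤ 2^{m/3}` (helper). [folklore] -/
private theorem one_le_theta (m : ℕ) : 1 ≤ theta m := by
  unfold theta
  calc (1 : ℝ) = 2 ^ (0 : ℝ) := (Real.rpow_zero 2).symm
    _ ≤ 2 ^ ((m : ℝ) / 3) := Real.rpow_le_rpow_of_exponent_le one_le_two (by positivity)

/-- `2 ≤ 2^{m/3}` for `m ≥ 3` (helper). [folklore] -/
private theorem two_le_theta {m : ℕ} (hm : 3 ≤ m) : 2 ≤ theta m := by
  unfold theta
  calc (2 : ℝ) = 2 ^ (1 : ℝ) := (Real.rpow_one 2).symm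
    _ ≤ 2 ^ ((m : ℝ) / 3) := Real.rpow_le_rpow_of_exponent_le one_le_two (by
        have : (3 : ℝ) ≤ m := by exact_mod_cast hm
        linarith)

/-- `3/2 ≤ 2^{2/3}` (helper). [folklore] -/
private theorem three_halves_le_theta_two : 3 / 2 ≤ theta 2 := by
  have h3 := theta_pow_three 2
  by_contra h
  have hlt : theta 2 < 3 / 2 := lt_of_not_ge h
  have hQ : 0 < theta 2 ^ 2 + 3 / 2 * theta 2 + 9 / 4 := by have := theta_pos 2; positivity
  have hprod : (theta 2 - 3 / 2) * (theta 2 ^ 2 + 3 / 2 * theta 2 + 9 / 4) < 0 :=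
    mul_neg_of_neg_of_pos (by linarith) hQ
  have hid : (theta 2 - 3 / 2) * (theta 2 ^ 2 + 3 / 2 * theta 2 + 9 / 4) = theta 2 ^ 3 - 27 / 8 := by
    ring
  rw [hid, h3] at hprod
  norm_num at hprod

/-- The elementary inequality behind `Σ_{i<m} b_i ≤ 1/2`: `2 (2^m - 1) ≤ 2^m · 2^{m/3}` for
`m ≥ 1` (helper; cases `m = 1, 2` and `m ≥ 3`). [folklore] -/
private theorem two_mul_pow_sub_one_le (m : ℕ) (hm : 1 ≤ m) :
    2 * ((2 : ℝ) ^ m - 1) ≤ 2 ^ m * theta m := by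
  rcases Nat.lt_or_ge m 3 with h | h
  · interval_cases m
    · have := one_le_theta 1; nlinarith
    · have := three_halves_le_theta_two; nlinarith
  · have := two_le_theta h
    have h2 : (0 : ℝ) < 2 ^ m := by positivity
    nlinarith

/-- `R_j = 8^m / 4^j` (`= 2^{3m-2j}` for `j ≤ m`), the scale of the stage-`j` floor.
[cite: Kuperberg2005, §3.1 proof of Thm 3.1] -/
def R (m j : ℕ) : ℝ := 8 ^ m / 4 ^ j

/-- `R_j > 0`. [cite: Kuperberg2005, §3.1 proof of Thm 3.1] -/
theorem R_pos (m j : ℕ) : 0 < R m j := by unfold R; positivity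

/-- `R_{j+1} = R_j/4`: "`|L_{j+1}|/|L_j| ≈ 1/4`". [cite: Kuperberg2005, §3.1 proof of Thm 3.1] -/
theorem R_succ (m j : ℕ) : R m (j + 1) = R m j / 4 := by
  unfold R; rw [pow_succ]; field_simp

/-- `R_m = 2^m`: "We can set `|L_m| = Θ(2^m)`". [cite: Kuperberg2005, §3.1 proof of Thm 3.1] -/
theorem R_self (m : ℕ) : R m m = 2 ^ m := by
  unfold R
  rw [show (8 : ℝ) = 2 * 4 by norm_num, mul_pow]
  field_simp

/-- `b_j = 2^{j - 4m/3} = 2^j / (2^m · 2^{m/3})`. [cite: Kuperberg2005, §3.1 proof of Thm 3.1] -/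
def bCoef (m j : ℕ) : ℝ := 2 ^ j / (2 ^ m * theta m)

/-- `b_j ≥ 0`. [cite: Kuperberg2005, §3.1 proof of Thm 3.1] -/
theorem bCoef_nonneg (m j : ℕ) : 0 ≤ bCoef m j := by
  unfold bCoef; have := theta_pos m; positivity

/-- `b_j ≤ 1/2` for `j < m` (as `2^{m/3} ≥ 1`). [cite: Kuperberg2005, §3.1 proof of Thm 3.1] -/
theorem bCoef_le_half {m j : ℕ} (hj : j < m) : bCoef m j ≤ 1 / 2 := by
  unfold bCoef
  have hθ := one_le_theta m
  have h2m : (0 : ℝ) < 2 ^ m := by positivity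
  rw [div_le_iff₀ (by positivity)]
  have hjm : (2 : ℝ) ^ j * 2 ≤ 2 ^ m := by
    rw [← pow_succ]; exact pow_le_pow_right₀ one_le_two hj
  nlinarith

/-- `b_j² R_j = 2^{2j - 8m/3} 2^{3m-2j} = 2^{m/3}`: the exponent in the Chernoff bound does not
depend on the stage. [cite: Kuperberg2005, §3.1 proof of Thm 3.1] -/
theorem bCoef_sq_mul_R (m j : ℕ) : bCoef m j ^ 2 * R m j = theta m := by
  have hθ := theta_pos m
  have h3 := theta_pow_three m
  have h8 : (8 : ℝ) ^ m = (2 ^ m) ^ 3 := by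
    rw [← pow_mul, show (8 : ℝ) = 2 ^ 3 by norm_num, ← pow_mul, mul_comm]
  have h4j : (4 : ℝ) ^ j = (2 ^ j) ^ 2 := by
    rw [← pow_mul, show (4 : ℝ) = 2 ^ 2 by norm_num, ← pow_mul, mul_comm]
  have h2j : (0 : ℝ) < 2 ^ j := by positivity
  unfold bCoef R
  rw [h4j, h8, ← h3]
  field_simp

/-- `c_j = (2^m + 1)/R_j`, the relative loss from the `≤ 2^m` unmatched labels (and the integer
part of `(s - 2^m)/2`). [cite: Kuperberg2005, §3.1 proof of Thm 3.1] -/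
def cCoef (m j : ℕ) : ℝ := (2 ^ m + 1) / R m j

/-- `c_j ≥ 0`. [cite: Kuperberg2005, §3.1 proof of Thm 3.1] -/
theorem cCoef_nonneg (m j : ℕ) : 0 ≤ cCoef m j := by
  unfold cCoef; have := R_pos m j; positivity

/-- `c_j R_j = 2^m + 1`. [cite: Kuperberg2005, §3.1 proof of Thm 3.1] -/
theorem cCoef_mul_R (m j : ℕ) : cCoef m j * R m j = 2 ^ m + 1 := by
  unfold cCoef; field_simp [(R_pos m j).ne']

/-- `Σ_{i<m} b_i = (2^m - 1)/(2^m 2^{m/3}) ≤ 1/2`. [cite: Kuperberg2005, §3.1 proof of Thm 3.1] -/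
theorem sum_bCoef_le {m : ℕ} (hm : 1 ≤ m) : ∑ i ∈ range m, bCoef m i ≤ 1 / 2 := by
  have hθ := theta_pos m
  have h2m : (0 : ℝ) < 2 ^ m := by positivity
  unfold bCoef
  rw [← sum_div, geom_sum_eq (by norm_num : (2 : ℝ) ≠ 1), show (2 : ℝ) - 1 = 1 by norm_num,
    div_one, div_le_iff₀ (by positivity)]
  have := two_mul_pow_sub_one_le m hm
  linarith

/-- `Σ_{i<m} c_i = (2^m + 1)(4^m - 1)/(3 · 8^m) ≤ 1/2`. [cite: Kuperberg2005, §3.1 proof of Thm 3.1] -/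
theorem sum_cCoef_le {m : ℕ} (hm : 1 ≤ m) : ∑ i ∈ range m, cCoef m i ≤ 1 / 2 := by
  have h8 : (0 : ℝ) < 8 ^ m := by positivity
  have hc : ∀ i, cCoef m i = (2 ^ m + 1) / 8 ^ m * 4 ^ i := fun i => by
    unfold cCoef R; field_simp
  have hsum : ∑ i ∈ range m, cCoef m i = (2 ^ m + 1) * (4 ^ m - 1) / (3 * 8 ^ m) := by
    simp_rw [hc, ← mul_sum, geom_sum_eq (by norm_num : (4 : ℝ) ≠ 1)]
    field_simp
    ring
  rw [hsum,
    show (8 : ℝ) ^ m = (2 ^ m) ^ 3 by rw [← pow_mul, show (8 : ℝ) = 2 ^ 3 by norm_num, ← pow_mul, mul_comm],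
    show (4 : ℝ) ^ m = (2 ^ m) ^ 2 by rw [← pow_mul, show (4 : ℝ) = 2 ^ 2 by norm_num, ← pow_mul, mul_comm]]
  have hX : (2 : ℝ) ≤ 2 ^ m := by
    calc (2 : ℝ) = 2 ^ 1 := (pow_one 2).symm
      _ ≤ 2 ^ m := pow_le_pow_right₀ one_le_two hm
  set X : ℝ := 2 ^ m with hXdef
  have hX3 : (0 : ℝ) < 3 * X ^ 3 := by positivity
  rw [div_le_iff₀ hX3]
  nlinarith [sq_nonneg X, mul_nonneg (sub_nonneg.2 hX) (sq_nonneg X)]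

/-- The forward floor constants: `A₀ = 9`, `A_{j+1} = (1 - b_j)(A_j - c_j)`.
[cite: Kuperberg2005, §3.1 proof of Thm 3.1 (constants `C_k`)] -/
def A (m : ℕ) : ℕ → ℝ
  | 0 => 9
  | j + 1 => (1 - bCoef m j) * (A m j - cCoef m j)

/-- `A₀ = 9`. [cite: Kuperberg2005, §3.1 proof of Thm 3.1] -/
@[simp] theorem A_zero (m : ℕ) : A m 0 = 9 := rfl

/-- The recursion `A_{j+1} = (1 - b_j)(A_j - c_j)`. [cite: Kuperberg2005, §3.1 proof of Thm 3.1] -/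
theorem A_succ (m j : ℕ) : A m (j + 1) = (1 - bCoef m j) * (A m j - cCoef m j) := rfl

/-- The linearised invariant: `9 - 9 Σ_{i<j} b_i - Σ_{i<j} c_i ≤ A_j ≤ 9` for `j ≤ m` ("It is not hard to
check that `C_k > C_{k-1}`, `lim C_k < 9`"). [cite: Kuperberg2005, §3.1 proof of Thm 3.1] -/
theorem A_bounds {m : ℕ} (hm : 1 ≤ m) :
    ∀ j, j ≤ m → 9 - 9 * ∑ i ∈ range j, bCoef m i - ∑ i ∈ range j, cCoef m i ≤ A m j ∧ A m j ≤ 9 := by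
  intro j
  induction j with
  | zero => intro _; simp
  | succ j ih =>
    intro hj
    obtain ⟨hlo, hhi⟩ := ih (by omega)
    have hb0 := bCoef_nonneg m j
    have hb1 : bCoef m j ≤ 1 / 2 := bCoef_le_half (by omega)
    have hc0 := cCoef_nonneg m j
    -- partial sums are bounded by the full sums
    have hsb : ∑ i ∈ range j, bCoef m i ≤ 1 / 2 :=
      (sum_le_sum_of_subset_of_nonneg (range_mono (by omega)) fun i _ _ => bCoef_nonneg m i).trans
        (sum_bCoef_le hm)
    have hsc : ∑ i ∈ range j, cCoef m i + cCoef m j ≤ 1 / 2 := by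
      rw [← sum_range_succ]
      exact (sum_le_sum_of_subset_of_nonneg (range_mono (by omega)) fun i _ _ => cCoef_nonneg m i).trans
        (sum_cCoef_le hm)
    have hAc : 0 ≤ A m j - cCoef m j := by
      have : 0 ≤ ∑ i ∈ range j, cCoef m i := sum_nonneg fun i _ => cCoef_nonneg m i
      linarith
    rw [A_succ, sum_range_succ, sum_range_succ]
    constructor
    · nlinarith
    · nlinarith

/-- `3 ≤ A_j` for all `j ≤ m` (indeed `4 ≤ A_j`): the printed `C₀ = 3 ≤ C_k`.
[cite: Kuperberg2005, §3.1 proof of Thm 3.1] -/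
theorem three_le_A {m : ℕ} (hm : 1 ≤ m) {j : ℕ} (hj : j ≤ m) : 3 ≤ A m j := by
  have h := (A_bounds hm j hj).1
  have hsb : ∑ i ∈ range j, bCoef m i ≤ 1 / 2 :=
    (sum_le_sum_of_subset_of_nonneg (range_mono hj) fun i _ _ => bCoef_nonneg m i).trans
      (sum_bCoef_le hm)
  have hsc : ∑ i ∈ range j, cCoef m i ≤ 1 / 2 :=
    (sum_le_sum_of_subset_of_nonneg (range_mono hj) fun i _ _ => cCoef_nonneg m i).trans
      (sum_cCoef_le hm)
  linarith

/-- `A_j ≤ 9`: the printed `lim C_k < 9`, i.e. an initial list of `9 · 8^m` suffices.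
[cite: Kuperberg2005, §3.1 proof of Thm 3.1] -/
theorem A_le_nine {m : ℕ} (hm : 1 ≤ m) {j : ℕ} (hj : j ≤ m) : A m j ≤ 9 := (A_bounds hm j hj).2

/-- `A_{j+1} ≤ A_j - c_j` (as `0 ≤ 1 - b_j ≤ 1`). [cite: Kuperberg2005, §3.1 proof of Thm 3.1] -/
theorem A_succ_le {m : ℕ} (hm : 1 ≤ m) {j : ℕ} (hj : j < m) : A m (j + 1) ≤ A m j - cCoef m j := by
  have h3 := three_le_A hm (Nat.le_of_lt_succ (Nat.succ_lt_succ hj))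
  have hb0 := bCoef_nonneg m j
  have hb1 : bCoef m j ≤ 1 / 2 := bCoef_le_half hj
  rw [A_succ] at h3 ⊢
  have hAc : 0 ≤ A m j - cCoef m j := by
    by_contra hneg
    have hneg' : A m j - cCoef m j < 0 := lt_of_not_ge hneg
    have : (1 - bCoef m j) * (A m j - cCoef m j) ≤ 0 :=
      mul_nonpos_of_nonneg_of_nonpos (by linarith) hneg'.le
    linarith
  nlinarith

/-! ### One stage of Theorem 3.1 -/

/-- ONE STAGE [Kuperberg2005, §3.1, proof of Thm 3.1]: if `|L_j| ≥ A_j 2^{3m-2j}` (`j < m`) and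
`P_j` is any admissible set of pairs, then `|P_j| b_j² ≥ 2^{m/3}` and
`(1 - b_j)|P_j|/2 ≥ A_{j+1} 2^{3m-2j-2}`, so by the Chernoff bound the next list satisfies
`|L_{j+1}| ≥ A_{j+1} 2^{3m-2(j+1)}` except with probability at most `e^{-2^{m/3-1}}`.
[cite: Kuperberg2005, §3.1 Thm 3.1 (proof)] -/
theorem kuperberg_stage {m : ℕ} (hm : 1 ≤ m) {j : ℕ} (hj : j < m) (s : ℕ)
    (hs : A m j * R m j ≤ s) (p : ℕ) (hp : p ∈ admissiblePairs (2 ^ m) s) :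
    1 - Real.exp (-(theta m / 2)) ≤
      stageValue p (fun t => if A m (j + 1) * R m (j + 1) ≤ (t : ℝ) then 1 else 0) := by
  have hθ := theta_pos m
  have hRpos := R_pos m j
  have hb0 := bCoef_nonneg m j
  have hb1 : bCoef m j ≤ 1 / 2 := bCoef_le_half hj
  have hA3 : 3 ≤ A m (j + 1) := three_le_A hm hj
  have hAsucc : A m (j + 1) ≤ A m j - cCoef m j := A_succ_le hm hj
  have hcR := cCoef_mul_R m j
  have hbR := bCoef_sq_mul_R m j
  -- the admissible pair count in real form: `s - 2^m - 1 ≤ 2p`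
  obtain ⟨hp1, _⟩ := mem_admissiblePairs.1 hp
  have h2p_nat : s ≤ 2 * p + 2 ^ m + 1 := by omega
  have h2p : (s : ℝ) - 2 ^ m - 1 ≤ 2 * p := by
    have : (s : ℝ) ≤ 2 * p + 2 ^ m + 1 := by exact_mod_cast h2p_nat
    linarith
  -- hence `2p ≥ R_j (A_j - c_j) ≥ R_j A_{j+1}`
  have hpR : R m j * A m (j + 1) ≤ 2 * p := by
    have h1 : R m j * (A m j - cCoef m j) = A m j * R m j - (2 ^ m + 1) := by rw [← hcR]; ring
    have h2 : R m j * A m (j + 1) ≤ R m j * (A m j - cCoef m j) :=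
      mul_le_mul_of_nonneg_left hAsucc hRpos.le
    linarith
  -- `p ≥ 1`
  have hp0 : 0 < p := by
    have : (0 : ℝ) < 2 * p := lt_of_lt_of_le (by nlinarith) hpR
    exact_mod_cast (by linarith : (0 : ℝ) < p)
  -- Chernoff exponent: `p b_j² ≥ θ`
  have hexp : theta m / 2 ≤ p * bCoef m j ^ 2 / 2 := by
    have : theta m * A m (j + 1) ≤ 2 * p * bCoef m j ^ 2 := by
      calc theta m * A m (j + 1) = bCoef m j ^ 2 * (R m j * A m (j + 1)) := by rw [← hbR]; ring
        _ ≤ bCoef m j ^ 2 * (2 * p) := mul_le_mul_of_nonneg_left hpR (sq_nonneg _)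
        _ = 2 * p * bCoef m j ^ 2 := by ring
    nlinarith
  -- threshold: `(1 - b_j) p / 2 ≥ A_{j+1} R_{j+1}`
  have hthr : A m (j + 1) * R m (j + 1) ≤ (1 - bCoef m j) * p / 2 := by
    rw [R_succ, A_succ]
    have h1 : (A m j - cCoef m j) * R m j ≤ 2 * p := by nlinarith
    have h1b : 0 ≤ 1 - bCoef m j := by linarith
    calc (1 - bCoef m j) * (A m j - cCoef m j) * (R m j / 4)
        = (1 - bCoef m j) * ((A m j - cCoef m j) * R m j) / 4 := by ring
      _ ≤ (1 - bCoef m j) * (2 * p) / 4 := by gcongr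
      _ = (1 - bCoef m j) * p / 2 := by ring
  -- complement and Chernoff
  rw [stageValue_indicator_compl]
  have htail := coin_lower_tail hp0 hb0 (b := bCoef m j)
  have hmono : stageValue p (fun t => if A m (j + 1) * R m (j + 1) ≤ (t : ℝ) then 0 else 1) ≤
      stageValue p (fun t => if (t : ℝ) ≤ (1 - bCoef m j) * p / 2 then 1 else 0) := by
    refine stageValue_mono fun t _ => ?_
    by_cases h : A m (j + 1) * R m (j + 1) ≤ (t : ℝ)
    · rw [if_pos h]; split_ifs <;> norm_num
    · rw [if_neg h, if_pos (by have := lt_of_not_ge h; linarith)]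
  have hexp' : Real.exp (-(p * bCoef m j ^ 2 / 2)) ≤ Real.exp (-(theta m / 2)) :=
    Real.exp_le_exp.2 (by linarith)
  linarith

/-! ### Theorem 3.1 -/

/-- The printed floors `C₀ · 2^{3m-2j} = 3 · 8^m/4^j`. [cite: Kuperberg2005, §3.1 proof of Thm 3.1] -/
def floorK (m j : ℕ) : ℝ := 3 * 8 ^ m / 4 ^ j

/-- `3 · 8^m/4^j = 3 R_j`. [cite: Kuperberg2005, §3.1 proof of Thm 3.1] -/
theorem floorK_eq (m j : ℕ) : floorK m j = 3 * R m j := by unfold floorK R; ring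

/-- The final floor is `3 · 2^m` copies (of `|ψ_0⟩` or `|ψ_{2^{n-1}}⟩`). [cite: Kuperberg2005, §3.1 proof of Thm 3.1] -/
theorem floorK_self (m : ℕ) : floorK m m = 3 * 2 ^ m := by rw [floorK_eq, R_self]

/-- The printed floors are dominated by the invariant floors: `3 R_j ≤ A_j R_j`. [cite: Kuperberg2005, §3.1 proof of Thm 3.1] -/
theorem floorK_le_AR {m : ℕ} (hm : 1 ≤ m) {j : ℕ} (hj : j ≤ m) : floorK m j ≤ A m j * R m j := by
  rw [floorK_eq]
  exact mul_le_mul_of_nonneg_right (three_le_A hm hj) (R_pos m j).le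

/-- KUPERBERG 2005, THEOREM 3.1 (list sizes) [cite: Kuperberg2005, §3.1 Thm 3.1]: for `m ≥ 1`
stages with `2^m` low-bit classes, fair extraction coins and ANY admissible matchings, an
initial list of `|L₀| ≥ 9 · 8^m` qubits keeps `|L_j| ≥ 3 · 2^{3m-2j}` for all `1 ≤ j ≤ m`
(in particular `|L_m| ≥ 3 · 2^m`, `floorK_self`) with probability at least
`(1 - e^{-2^{m/3-1}})^m` — "`P[|L_j| ≥ C 2^{3m-2j} ∀ j] ≥ (1 - e^{-2^{m/3-1}})^m → 1` as
`m → ∞`", whence `O(8^{√n})` queries for `n ≤ m² + 1`.  Quantum states, the oracle and running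
time are not modelled (module docstring). -/
theorem kuperberg2005_thm31 {m : ℕ} (hm : 1 ≤ m) {s₀ : ℕ} (h₀ : 9 * 8 ^ m ≤ (s₀ : ℝ)) :
    (1 - Real.exp (-(2 : ℝ) ^ ((m : ℝ) / 3 - 1))) ^ m ≤ survive (2 ^ m) (floorK m) m 0 s₀ := by
  have hθ2 : (2 : ℝ) ^ ((m : ℝ) / 3 - 1) = theta m / 2 := by
    rw [Real.rpow_sub_one two_ne_zero]; rfl
  rw [hθ2]
  have hε : Real.exp (-(theta m / 2)) ≤ 1 := Real.exp_le_one_iff.2 (by have := theta_pos m; linarith)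
  refine le_survive_of_invariant (M := 2 ^ m) (m := m) (F := floorK m) (G := fun j => A m j * R m j)
    hε (fun j hj => floorK_le_AR hm hj) (fun j hj s hs p hp => kuperberg_stage hm hj s hs p hp)
    m 0 s₀ (by omega) ?_
  simpa [R] using h₀

/-- The same bound with a natural-number hypothesis on the initial list. [cite: Kuperberg2005, §3.1 Thm 3.1] -/
theorem kuperberg2005_thm31' {m : ℕ} (hm : 1 ≤ m) {s₀ : ℕ} (h₀ : 9 * 8 ^ m ≤ s₀) :
    (1 - Real.exp (-(2 : ℝ) ^ ((m : ℝ) / 3 - 1))) ^ m ≤ survive (2 ^ m) (floorK m) m 0 s₀ :=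
  kuperberg2005_thm31 hm (by exact_mod_cast h₀)

end

end Literature.Computability.Cryptography.KuperbergSieve
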